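import Mathlib.LinearAlgebra.Matrix.Trace
import Mathlib.Data.Matrix.Basis
import Mathlib.Analysis.Complex.Basic
import HarnessLib

/-!
# Powers of the one-plaquette conjugation channel `X ↦ A·X + B·tr(X)·1` on `M_N(ℂ)`: `S^n(X) = Aⁿ·X + ((A + NB)ⁿ − Aⁿ)/N · tr(X)·1` and the trace functional `Σ_{jk} Sⁿ(E_{jk})_{jk} = (A + NB)ⁿ + (N² − 1)Aⁿ`

HONEST FRAMING: exact (Metropolis-corrected) sampling algorithms for lattice gauge theory;
figures of merit are autocorrelation/cost numbers at stated couplings and volumes; no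
continuum-physics claim.

Venture `LatticeQCDFlow` (cell pub-lqcd), sub-topic `Scoring`; FANOUT row 5 (`s0-sun-a`), GEN-20.
NEW WORK of the cell (placement rule).  Third input of the exact second moment of two-dimensional Wilson loops.  By
`UNOnePlaquetteTwoPoint` the one-plaquette channel of `U(N)` is `S(X) = ∫ (UXU*) e^{βRe tr U} dU = A·X + B·tr(X)·1` with
`A + NB = D = det[I_{|i−j|}(β)]`; GEN-18's matrix area law iterates it `RT` times along an `R × T` Wilson loop.  Pure algebra
(Mathlib-only):

* **`conjChannel_iterate`** — for all `A B : ℂ`, `n`, `X`: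
  `S^[n] X = Aⁿ·X + (((A + N·B)ⁿ − Aⁿ)/N)·tr(X)·1` (`N ≥ 1`);
* **`sum_conjChannel_iterate_single`** — `Σ_{j,k} (S^[n] E_{jk})_{jk} = (A + N·B)ⁿ + (N² − 1)·Aⁿ`: with `A + NB = D` and
  `A/D = P_adj(β)` this is `Dⁿ·(1 + (N² − 1)·P_adjⁿ)` — the unnormalised `E|tr W|²` of an `n`-plaquette loop, whose normalised
  form `E|tr W_{R×T}|² = 1 + (N² − 1)·P_adj(β)^{RT}` is the exact signal-to-noise law of 2-d Wilson loops (assembly with the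
  area law left to the sequel).

No `def`, nothing cited as a fact, 0 sorry.
-/

noncomputable section

open Matrix Complex

namespace Summit.Ventures.LatticeQCDFlow.Scoring

section Channel

variable {N : ℕ}

/-- **Powers of the channel `X ↦ A·X + B·tr(X)·1`** (`N ≥ 1`):
`S^[n] X = Aⁿ·X + (((A + N·B)ⁿ − Aⁿ)/N)·tr(X)·1`. -/
theorem conjChannel_iterate [NeZero N] (A B : ℂ) (n : ℕ) (X : Matrix (Fin N) (Fin N) ℂ) :
    (fun Y : Matrix (Fin N) (Fin N) ℂ => A • Y + B • (Y.trace • (1 : Matrix (Fin N) (Fin N) ℂ)))^[n] X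
      = A ^ n • X + (((A + N * B) ^ n - A ^ n) / N) • (X.trace • (1 : Matrix (Fin N) (Fin N) ℂ)) := by
  have hN : (N : ℂ) ≠ 0 := Nat.cast_ne_zero.2 (NeZero.ne N)
  induction n with
  | zero => simp
  | succ n ih =>
    rw [Function.iterate_succ_apply', ih]
    have htr : (A ^ n • X + (((A + N * B) ^ n - A ^ n) / N) • (X.trace • (1 : Matrix (Fin N) (Fin N) ℂ))).trace
        = (A ^ n + ((A + N * B) ^ n - A ^ n)) * X.trace := by
      rw [Matrix.trace_add, Matrix.trace_smul, Matrix.trace_smul, Matrix.trace_smul, Matrix.trace_one, Fintype.card_fin,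
        smul_eq_mul, smul_eq_mul, smul_eq_mul]
      field_simp
    rw [htr]
    ext i j
    simp only [Matrix.add_apply, Matrix.smul_apply, smul_eq_mul, Matrix.one_apply]
    split_ifs
    · field_simp
      ring
    · ring

/-- **The trace functional of the iterated channel**: `Σ_{j,k} (S^[n] E_{jk})_{jk} = (A + N·B)ⁿ + (N² − 1)·Aⁿ`. -/
theorem sum_conjChannel_iterate_single [NeZero N] (A B : ℂ) (n : ℕ) :
    ∑ j : Fin N, ∑ k : Fin N,
      ((fun Y : Matrix (Fin N) (Fin N) ℂ => A • Y + B • (Y.trace • (1 : Matrix (Fin N) (Fin N) ℂ)))^[n]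
        (Matrix.single j k 1)) j k
      = (A + N * B) ^ n + ((N : ℂ) ^ 2 - 1) * A ^ n := by
  have hN : (N : ℂ) ≠ 0 := Nat.cast_ne_zero.2 (NeZero.ne N)
  have hterm : ∀ j k : Fin N,
      ((fun Y : Matrix (Fin N) (Fin N) ℂ => A • Y + B • (Y.trace • (1 : Matrix (Fin N) (Fin N) ℂ)))^[n]
        (Matrix.single j k 1)) j k = A ^ n + (if j = k then ((A + N * B) ^ n - A ^ n) / N else 0) := by
    intro j k
    rw [conjChannel_iterate, Matrix.add_apply, Matrix.smul_apply, Matrix.single_apply_same, smul_eq_mul, mul_one,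
      Matrix.smul_apply, Matrix.smul_apply, smul_eq_mul, smul_eq_mul]
    by_cases h : j = k
    · subst h; rw [Matrix.trace_single_eq_same, Matrix.one_apply_eq, if_pos rfl]; ring
    · rw [Matrix.trace_single_eq_of_ne (h := h), if_neg h]; ring
  simp_rw [hterm]
  simp only [Finset.sum_add_distrib, Finset.sum_const, Finset.card_univ, Fintype.card_fin, Finset.sum_ite_eq,
    Finset.mem_univ, if_true, nsmul_eq_mul]
  field_simp
  ring

end Channel

/-! ## §2. The channels as linear maps; powers of the congruence channel `Y ↦ A'·Y + B'·Yᵀ` (GEN-21)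

The `u ⊗ ū` channel above is an endomorphism of `M_N(ℂ)` whose `Module.End` powers are its iterates; the `u ⊗ u`
(congruence) channel of GEN-21's `UNOnePlaquetteSymmetricTwoPoint` is `Y ↦ A'·Y + B'·Yᵀ`, with powers
`S'ⁿY = aₙ·Y + bₙ·Yᵀ`, `2aₙ = (A'+B')ⁿ + (A'−B')ⁿ`, `2bₙ = (A'+B')ⁿ − (A'−B')ⁿ`, and trace functional
`Σ_{jk}(S'ⁿE_{jk})_{jk} = (N(N+1)/2)(A'+B')ⁿ + (N(N−1)/2)(A'−B')ⁿ` — the dimensions of `Sym²` and `Λ²` appear. -/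

section ChannelPowers

variable {N : ℕ}

/-- The affine-in-trace channel `X ↦ A·X + B·tr(X)·1` as a linear map, and its powers as iterates. -/
theorem conjChannel_linearMap_pow_apply [NeZero N] (A B : ℂ) (n : ℕ) (X : Matrix (Fin N) (Fin N) ℂ) :
    ((A • LinearMap.id + B • (Matrix.traceLinearMap (Fin N) ℂ ℂ).smulRight (1 : Matrix (Fin N) (Fin N) ℂ)) ^ n :
        Module.End ℂ (Matrix (Fin N) (Fin N) ℂ)) X =
      (fun Y : Matrix (Fin N) (Fin N) ℂ => A • Y + B • (Y.trace • (1 : Matrix (Fin N) (Fin N) ℂ)))^[n] X := by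
  rw [Module.End.pow_apply]
  congr 1
/-- **Powers of the channel `Y ↦ A'·Y + B'·Yᵀ`**:
`S'^[n] Y = ((A'+B')ⁿ + (A'−B')ⁿ)/2 · Y + ((A'+B')ⁿ − (A'−B')ⁿ)/2 · Yᵀ`. -/
theorem congrChannel_iterate (A B : ℂ) (n : ℕ) (Y : Matrix (Fin N) (Fin N) ℂ) :
    (fun Z : Matrix (Fin N) (Fin N) ℂ => A • Z + B • Zᵀ)^[n] Y
      = (((A + B) ^ n + (A - B) ^ n) / 2) • Y + (((A + B) ^ n - (A - B) ^ n) / 2) • Yᵀ := by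
  induction n with
  | zero => simp
  | succ n ih =>
    rw [Function.iterate_succ_apply', ih, Matrix.transpose_add, Matrix.transpose_smul, Matrix.transpose_smul,
      Matrix.transpose_transpose, smul_add, smul_add, smul_smul, smul_smul, smul_smul, smul_smul]
    -- collect the `Y` and `Yᵀ` terms
    have e1 : A * (((A + B) ^ n + (A - B) ^ n) / 2) + B * (((A + B) ^ n - (A - B) ^ n) / 2)
        = ((A + B) ^ (n + 1) + (A - B) ^ (n + 1)) / 2 := by ring
    have e2 : A * (((A + B) ^ n - (A - B) ^ n) / 2) + B * (((A + B) ^ n + (A - B) ^ n) / 2)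
        = ((A + B) ^ (n + 1) - (A - B) ^ (n + 1)) / 2 := by ring
    rw [← e1, ← e2, add_smul, add_smul]
    abel

/-- **The trace functional of the iterated congruence channel**:
`Σ_{j,k} (S'^[n] E_{jk})_{jk} = (N(N+1)/2)·(A'+B')ⁿ + (N(N−1)/2)·(A'−B')ⁿ`. -/
theorem sum_congrChannel_iterate_single (A B : ℂ) (n : ℕ) :
    ∑ j : Fin N, ∑ k : Fin N,
      ((fun Z : Matrix (Fin N) (Fin N) ℂ => A • Z + B • Zᵀ)^[n] (Matrix.single j k 1)) j k
      = ((N : ℂ) * (N + 1) / 2) * (A + B) ^ n + ((N : ℂ) * (N - 1) / 2) * (A - B) ^ n := by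
  have hterm : ∀ j k : Fin N,
      ((fun Z : Matrix (Fin N) (Fin N) ℂ => A • Z + B • Zᵀ)^[n] (Matrix.single j k 1)) j k
        = ((A + B) ^ n + (A - B) ^ n) / 2 + (if j = k then ((A + B) ^ n - (A - B) ^ n) / 2 else 0) := by
    intro j k
    rw [congrChannel_iterate]
    by_cases h : j = k
    · subst h; simp
    · simp [h]
  simp_rw [hterm]
  simp only [Finset.sum_add_distrib, Finset.sum_const, Finset.card_univ, Fintype.card_fin, Finset.sum_ite_eq,
    Finset.mem_univ, if_true, nsmul_eq_mul]
  ring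

/-- The channel `Y ↦ A'·Y + B'·Yᵀ` as a linear map, and its powers as iterates. -/
theorem congrChannel_linearMap_pow_apply (A B : ℂ) (τ : Module.End ℂ (Matrix (Fin N) (Fin N) ℂ))
    (hτ : ∀ Y, τ Y = Yᵀ) (n : ℕ) (X : Matrix (Fin N) (Fin N) ℂ) :
    ((A • LinearMap.id + B • τ) ^ n : Module.End ℂ (Matrix (Fin N) (Fin N) ℂ)) X =
      (fun Z : Matrix (Fin N) (Fin N) ℂ => A • Z + B • Zᵀ)^[n] X := by
  rw [Module.End.pow_apply]
  congr 1
  funext Z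
  simp [hτ]

end ChannelPowers

end Summit.Ventures.LatticeQCDFlow.Scoring
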